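import Mathlib
import HarnessLib
import Literature.Probability.LatticeModels.TorusFourierWeightedConvolution

/-!
# K3 gen-8-FLOW (stmt 20437, stub (C), located risk «(C)-B-REP», sup/aliasing route, p2 side (R59bl)): the COEFFICIENT TAIL of lattice kernel data
# beyond `|x̃|_∞ > R` from ANY higher position moment

Cell gate-hubbard-kl, seat p2 g13 (memo `B-CT-DESIGN-p2g13.md` §3 (ii)).  The sup route splits lattice two-leg data `H` (cosine/Fourier coefficients `Ȟ(x)`,
`x̃` the centred representative) into the part RESOLVED by the grid (`|x̃|_∞ ≤ L/4`) and the far tail; the far tail is paid by a higher moment: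
for `j ≤ s` and a threshold `R`,

* **`sum_far_momentWeight_mul_le`** — `Σ_{x : R < |x̃₀| ∨ R < |x̃₁|} (1+|x̃₀|+|x̃₁|)ʲ·a(x) ≤ (1+R)^{−(s−j)}·Σ_x (1+|x̃₀|+|x̃₁|)ˢ·a(x)` for any `a ≥ 0`
  (on the far set `1 + R ≤ 1+|x̃₀|+|x̃₁|`, so `(1+|x̃|)ʲ ≤ (1+|x̃|)ˢ/(1+R)^{s−j}`);
* `sum_far_momentWeight_norm_torusFourierInv_le` — the instance `a = ‖𝔉⁻¹[H](x)‖`: far coefficient mass with weight `j` ≤ `M_s(H)/(1+R)^{s−j}`.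

With `R = L/4` and the door's moments `M_s(H) ≲ (U/βL²)·(C·4^m/klE0)^s` this is `tiny(L)` at any power (memo §3).  Proofs only; nothing about the model is asserted.
References: BGM 2006 §2.3 (2.17) [cite: BenfattoGiulianiMastropietro2006]; Boyd 2001 §4.5 [cite: Boyd2001].
-/

noncomputable section

namespace Summit.HubbardSuperconductivity.HubbardSuperconductivity.Theorems.EngineV8

set_option linter.dupNamespace false -- summit = problem name (single-conjunct summit), D-0017

open Finset Literature.Probability.LatticeModels

variable {L : ℕ} [NeZero L]

/-- **Far tail from a higher moment**: for `a ≥ 0`, `j ≤ s`, `0 ≤ R`,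
`Σ_{x : R < |x̃₀| ∨ R < |x̃₁|} (1+|x̃₀|+|x̃₁|)ʲ·a(x) ≤ ((1+R)^{s−j})⁻¹·Σ_x (1+|x̃₀|+|x̃₁|)ˢ·a(x)`. -/
theorem sum_far_momentWeight_mul_le (a : TorusSite 2 L → ℝ) (ha : ∀ x, 0 ≤ a x) {j s : ℕ} (hjs : j ≤ s) {R : ℝ} (hR : 0 ≤ R) :
    ∑ x ∈ (univ : Finset (TorusSite 2 L)).filter (fun x => R < ((x 0).valMinAbs.natAbs : ℝ) ∨ R < ((x 1).valMinAbs.natAbs : ℝ)),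
        (1 + ((x 0).valMinAbs.natAbs : ℝ) + ((x 1).valMinAbs.natAbs : ℝ)) ^ j * a x ≤
      ((1 + R) ^ (s - j))⁻¹ * ∑ x : TorusSite 2 L, (1 + ((x 0).valMinAbs.natAbs : ℝ) + ((x 1).valMinAbs.natAbs : ℝ)) ^ s * a x := by
  have h1R : 0 < (1 + R) ^ (s - j) := by positivity
  rw [mul_sum]
  refine (sum_le_sum_of_subset_of_nonneg (filter_subset _ _) fun x _ _ => ?_).trans' (sum_le_sum fun x hx => ?_)
  · exact mul_nonneg (inv_nonneg.2 h1R.le) (mul_nonneg (by positivity) (ha x))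
  · have hfar : 1 + R ≤ 1 + ((x 0).valMinAbs.natAbs : ℝ) + ((x 1).valMinAbs.natAbs : ℝ) := by
      have h0 : (0 : ℝ) ≤ ((x 0).valMinAbs.natAbs : ℝ) := Nat.cast_nonneg _
      have h1 : (0 : ℝ) ≤ ((x 1).valMinAbs.natAbs : ℝ) := Nat.cast_nonneg _
      rcases (mem_filter.1 hx).2 with h | h <;> linarith
    set W : ℝ := 1 + ((x 0).valMinAbs.natAbs : ℝ) + ((x 1).valMinAbs.natAbs : ℝ) with hW
    have hW0 : 0 < W := by rw [hW]; positivity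
    -- `W^j ≤ W^s/(1+R)^{s-j}`
    have hpow : W ^ j ≤ ((1 + R) ^ (s - j))⁻¹ * W ^ s := by
      rw [le_inv_mul_iff₀ h1R, show s = j + (s - j) by omega, pow_add, Nat.add_sub_cancel_left, mul_comm]
      exact mul_le_mul_of_nonneg_left (pow_le_pow_left₀ (by positivity) hfar _) (pow_nonneg hW0.le _)
    calc W ^ j * a x ≤ ((1 + R) ^ (s - j))⁻¹ * W ^ s * a x := mul_le_mul_of_nonneg_right hpow (ha x)
      _ = ((1 + R) ^ (s - j))⁻¹ * (W ^ s * a x) := by ring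

/-- **Far coefficient mass of lattice data from its `s`-th moment**: with `M_s(H) = Σ_x (1+|x̃₀|+|x̃₁|)ˢ‖𝔉⁻¹[H](x)‖`,
`Σ_{x : R < |x̃₀| ∨ R < |x̃₁|} (1+|x̃₀|+|x̃₁|)ʲ‖𝔉⁻¹[H](x)‖ ≤ M_s(H)/(1+R)^{s−j}`. -/
theorem sum_far_momentWeight_norm_torusFourierInv_le (H : TorusSite 2 L → ℂ) {j s : ℕ} (hjs : j ≤ s) {R : ℝ} (hR : 0 ≤ R) {Ms : ℝ}
    (hM : ∑ x : TorusSite 2 L, (1 + ((x 0).valMinAbs.natAbs : ℝ) + ((x 1).valMinAbs.natAbs : ℝ)) ^ s * ‖torusFourierInv H x‖ ≤ Ms) :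
    ∑ x ∈ (univ : Finset (TorusSite 2 L)).filter (fun x => R < ((x 0).valMinAbs.natAbs : ℝ) ∨ R < ((x 1).valMinAbs.natAbs : ℝ)),
        (1 + ((x 0).valMinAbs.natAbs : ℝ) + ((x 1).valMinAbs.natAbs : ℝ)) ^ j * ‖torusFourierInv H x‖ ≤ Ms / (1 + R) ^ (s - j) := by
  refine (sum_far_momentWeight_mul_le (fun x => ‖torusFourierInv H x‖) (fun _ => norm_nonneg _) hjs hR).trans ?_
  rw [div_eq_inv_mul]
  exact mul_le_mul_of_nonneg_left hM (by positivity)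

end Summit.HubbardSuperconductivity.HubbardSuperconductivity.Theorems.EngineV8

end
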